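import Mathlib.RingTheory.MvPowerSeries.Basic
import Mathlib.RingTheory.MvPowerSeries.Order
import HarnessLib

/-!
# Cleaning of formal power series (purely inseparable equations `z^{pᵉ} + F(x) = 0`)

Topic: `Literature/AlgebraicGeometry/Resolution`. Power-series companion of
`Hauser2010.deletePthPowers` (polynomials) and of the Hauser–Perlega setting
`Literature/Barriers/ResolutionOfSingularities/ResidualOrderUnbounded.lean` (`HauserPerlega.IsClean`,
polynomials): the two operations on a formal power series `F ∈ K[[x]]` that occur in every
transformation step of a purely inseparable equation `f = z^{pᵉ} + F(x₁, …, xₙ)`.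

* Hauser–Perlega, §2 "Setting" (arXiv:1802.05010 = J. Algebraic Geom. 28 (2019)), verbatim:
  "purely inseparable equations of the form `f(z,x) = z^{pᵉ} + F(x₁,…,xₙ) = 0`, where `e` is a
  positive integer and `F ∈ K[[x₁,…,xₙ]]` is a power series of order `ord F ≥ pᵉ`"; "a change of
  parameters `z₁ = z − g` … changes the expansion of `f` to `f = z₁^{pᵉ} + g^{pᵉ} + F`. Hence, any
  `pᵉ`-th power that appears in the expansion of `F` can be eliminated via such a change. … We then
  say that `F` is *clean* if no `pᵉ`-th powers appear in its expansion. Respectively, we refer to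
  a change of parameters `z₁ = z − g` which eliminates all `pᵉ`-th powers from `F` as *cleaning*";
  "The strict transform of `f` under `π` has the form `f' = z^{pᵉ} + F'(x₁,…,xₙ)` … After applying
  cleaning, we obtain a new expansion `f' = z^{pᵉ} + F'_clean`". [cite: HauserPerlega2019, §2]
* Moh (1987) introduced this bookkeeping (residual order of the cleaned coefficient) for the
  Stability Theorem. [cite: Moh1987, §1]

## Lean rendering

Over a perfect field of characteristic `p` a monomial `c·x^α` is a `q = pᵉ`-th power iff
`q ∣ αₗ` for every `l`, so "deleting the `q`-th powers" is the coefficientwise operation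
`qClean q F` below (keep exactly the monomials with some exponent not divisible by `q`); it is
defined over any semiring and for any `q : ℕ`. The constant term of the transform is absorbed
into `z` in the same way (`z ↦ z − c₀^{1/q}`), which is `succCoeff` (subtract the constant
term). Contents: `qClean`, `coeff_qClean_of_dvd`, `coeff_qClean_of_not_dvd`,
`constantCoeff_qClean`, `qClean_zero`, `qClean_add`, `qClean_qClean`, `qClean_eq_self`,
`isClean_qClean`; `succCoeff`, `constantCoeff_succCoeff`, `coeff_succCoeff_of_ne_zero`,
`succCoeff_eq_self`.
-/

namespace Literature.AlgebraicGeometry.Resolution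

variable {σ : Type*} {K : Type*}

section Clean

variable [Semiring K]

/-- **`q`-cleaning** of a formal power series: delete the monomials `c·x^α` all of whose
exponents are divisible by `q` (for `q = pᵉ` over a perfect field of characteristic `p` these are
exactly the `pᵉ`-th powers, which a change `z ↦ z − g` removes from the equation
`z^{pᵉ} + F(x)`; Hauser–Perlega §2 "cleaning"). [cite: HauserPerlega2019, §2] -/
noncomputable def qClean (q : ℕ) (F : MvPowerSeries σ K) : MvPowerSeries σ K :=
  fun α => by classical exact if ∀ l, q ∣ α l then 0 else MvPowerSeries.coeff α F

/-- A `q`-th-power monomial has coefficient `0` after cleaning. [folklore] -/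
theorem coeff_qClean_of_dvd (q : ℕ) (F : MvPowerSeries σ K) {α : σ →₀ ℕ} (h : ∀ l, q ∣ α l) :
    MvPowerSeries.coeff α (qClean q F) = 0 := by
  classical
  rw [MvPowerSeries.coeff_apply]
  simp [qClean, h]

/-- A monomial that is not a `q`-th power keeps its coefficient after cleaning. [folklore] -/
theorem coeff_qClean_of_not_dvd (q : ℕ) (F : MvPowerSeries σ K) {α : σ →₀ ℕ}
    (h : ¬ ∀ l, q ∣ α l) : MvPowerSeries.coeff α (qClean q F) = MvPowerSeries.coeff α F := by
  classical
  rw [MvPowerSeries.coeff_apply (qClean q F)]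
  simp [qClean, h]

/-- The cleaned series has no constant term. [folklore] -/
@[simp]
theorem constantCoeff_qClean (q : ℕ) (F : MvPowerSeries σ K) :
    MvPowerSeries.constantCoeff (qClean q F) = 0 := by
  rw [← MvPowerSeries.coeff_zero_eq_constantCoeff_apply]
  exact coeff_qClean_of_dvd q F fun l => by simp

/-- Cleaning `0` gives `0`. [folklore] -/
@[simp]
theorem qClean_zero (q : ℕ) : qClean q (0 : MvPowerSeries σ K) = 0 := by
  ext α
  by_cases h : ∀ l, q ∣ α l
  · rw [coeff_qClean_of_dvd q _ h, map_zero]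
  · rw [coeff_qClean_of_not_dvd q _ h]

/-- Cleaning is additive. [folklore] -/
theorem qClean_add (q : ℕ) (F G : MvPowerSeries σ K) :
    qClean q (F + G) = qClean q F + qClean q G := by
  ext α
  by_cases h : ∀ l, q ∣ α l
  · simp [coeff_qClean_of_dvd q _ h]
  · simp [coeff_qClean_of_not_dvd q _ h]

/-- Cleaning is idempotent. [folklore] -/
@[simp]
theorem qClean_qClean (q : ℕ) (F : MvPowerSeries σ K) : qClean q (qClean q F) = qClean q F := by
  ext α
  by_cases h : ∀ l, q ∣ α l
  · simp [coeff_qClean_of_dvd q _ h]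
  · simp [coeff_qClean_of_not_dvd q _ h]

/-- The cleaned series is clean: all its `q`-th-power coefficients vanish. [folklore] -/
theorem isClean_qClean (q : ℕ) (F : MvPowerSeries σ K) :
    ∀ α : σ →₀ ℕ, (∀ l, q ∣ α l) → MvPowerSeries.coeff α (qClean q F) = 0 :=
  fun _ h => coeff_qClean_of_dvd q F h

/-- A clean series is unchanged by cleaning. [folklore] -/
theorem qClean_eq_self (q : ℕ) {F : MvPowerSeries σ K}
    (hF : ∀ α : σ →₀ ℕ, (∀ l, q ∣ α l) → MvPowerSeries.coeff α F = 0) : qClean q F = F := by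
  ext α
  by_cases h : ∀ l, q ∣ α l
  · rw [coeff_qClean_of_dvd q _ h, hF α h]
  · rw [coeff_qClean_of_not_dvd q _ h]

end Clean

section Succ

variable [Ring K]

/-- The **successor coefficient series**: `T` minus its constant term. For the transform
`z'^{q} + T(s, y)` of a purely inseparable equation at an exceptional point, the constant term
`c₀ = T(0)` is absorbed into `z'` (`z' ↦ z' − c₀^{1/q}` over a perfect field, the case `g = c₀^{1/q}`
of Hauser–Perlega's "any `pᵉ`-th power … can be eliminated"), leaving the new coefficient series
`F' = T − c₀`. [cite: HauserPerlega2019, §2] -/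
noncomputable def succCoeff (T : MvPowerSeries σ K) : MvPowerSeries σ K :=
  T - MvPowerSeries.C (MvPowerSeries.constantCoeff T)

/-- The successor coefficient series has no constant term. [folklore] -/
@[simp]
theorem constantCoeff_succCoeff (T : MvPowerSeries σ K) :
    MvPowerSeries.constantCoeff (succCoeff T) = 0 := by
  simp [succCoeff]

/-- Away from the constant term, `succCoeff T` and `T` have the same coefficients. [folklore] -/
theorem coeff_succCoeff_of_ne_zero (T : MvPowerSeries σ K) {α : σ →₀ ℕ} (hα : α ≠ 0) :
    MvPowerSeries.coeff α (succCoeff T) = MvPowerSeries.coeff α T := by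
  classical
  simp [succCoeff, MvPowerSeries.coeff_C, hα]

/-- A series without constant term is its own successor coefficient series. [folklore] -/
theorem succCoeff_eq_self {T : MvPowerSeries σ K} (hT : MvPowerSeries.constantCoeff T = 0) :
    succCoeff T = T := by
  simp [succCoeff, hT]

end Succ

end Literature.AlgebraicGeometry.Resolution
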